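import Mathlib
import HarnessLib
import Literature.MathematicalPhysics.QuantumLattice.SectorisedKernelNorm
import Literature.MathematicalPhysics.QuantumLattice.GrassmannChargeScaling

/-!
# Route `KLProgramme` — ENGINE (stmt-HubbardSuperconductivity-20437 `KLRegimeEngineV17F2`), row (b) binders #5 (E4) / #6 `hplainE1`, cure (α) of located candidate
# #25 «(b)-PLAIN-UV-TAIL»: the UV-CUT BRIDGE — sectorised kernels of a leg-rescaled element `S_g T` are the sectorised kernels of `T` at the multipliers `F_ω·g`,
# hence EQUAL to those of `T` whenever the sector multipliers absorb the cut (`F_ω·g = F_ω`)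
# (cell gate-hubbard-kl, seat hubbard-kl-k3c2-p2 g33)

Cure (α) re-keys the PLAIN (`trivialMultiplier`) position-space quartic rows of row (b) to the leg-rescaled element `S_g 𝒱_i := map (mulLeft ĝ) 𝒱_i`,
`ĝ((k,σ),c) = g(k)` a one-sector UV cutoff at a PHYSICAL scale (so that the bare vertex's integer-truncation tail is cut away and the plain currency is
M-uniform), and must show the consumers lose nothing: the aniso-from-plain transfer (`wprescribedSum_klAniso_le_of_plain_treeWt`, k3c2-p3) is stated for an
ARBITRARY Grassmann element and its plain kernel, and the sectorised kernels it produces for `S_g 𝒱_i` coincide with those of `𝒱_i` because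
`klAnisoFamily … J ω · g = klAnisoFamily … J ω` (the BGM multipliers live far below the cut).  This file is the two generic identities:
* `klbv_sectorisedKernel_map_mulLeft` — `sectorisedKernel β F (S_ĝ T) m Ω x = sectorisedKernel β (fun ω k => F ω k * g k) T m Ω x` (`kernel_map_mulLeft`);
* `klbv_sectorisedKernel_map_mulLeft_of_absorb` — if `∀ ω k, F ω k * g k = F ω k` then `sectorisedKernel β F (S_ĝ T) = sectorisedKernel β F T`.
Pure algebra; no definitions; nothing asserts any row, (b), K3 or superconductivity.
References: BGM 2006 §2.5 (2.48), §2.7 (2.70)–(2.71) [cite: BenfattoGiulianiMastropietro2006].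
-/

noncomputable section

namespace Summit.HubbardSuperconductivity.HubbardSuperconductivity.Theorems.KLRegimeSplit

set_option linter.dupNamespace false -- summit = problem name (single-conjunct summit), D-0017

open Finset Literature.MathematicalPhysics.QuantumLattice Literature.Probability.LatticeModels GrassmannAlgebra

variable {L M : ℕ} [NeZero L]

/-- **Sectorised kernels of a leg-rescaled element**: for `ĝ((k,σ),c) = g k`,
`sectorisedKernel β F (map (mulLeft ĝ) T) m Ω x = sectorisedKernel β (fun ω k => F ω k * g k) T m Ω x`. -/
theorem klbv_sectorisedKernel_map_mulLeft {N : ℕ} (β : ℝ) (F : Fin N → FreqMomentum L M → ℂ) (g : FreqMomentum L M → ℂ)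
    (T : HubbardGrassmann L M) (m : ℕ) (Ω : Fin m → SectorLeg N) (x : Fin m → SpaceTimeIdx L M) :
    sectorisedKernel L M β F (ExteriorAlgebra.map (LinearMap.mulLeft ℂ (fun K : HubbardFieldIdx L M => g K.1.1)) T) m Ω x =
      sectorisedKernel L M β (fun ω k => F ω k * g k) T m Ω x := by
  rw [sectorisedKernel_def, sectorisedKernel_def]
  refine sum_congr rfl fun k _ => ?_
  rw [kernel_map_mulLeft, ← mul_assoc]
  congr 1
  rw [← prod_mul_distrib]
  exact prod_congr rfl fun i _ => by ring

/-- **The cut is invisible to multipliers that absorb it**: if `F_ω·g = F_ω` for every sector then the sectorised kernels of `map (mulLeft ĝ) T` and of `T`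
coincide — the consumers of the sectorised rows read the same numbers whether the plain rows are stated for `T` or for its UV-cut rescaling. -/
theorem klbv_sectorisedKernel_map_mulLeft_of_absorb {N : ℕ} (β : ℝ) (F : Fin N → FreqMomentum L M → ℂ) (g : FreqMomentum L M → ℂ)
    (hFg : ∀ ω k, F ω k * g k = F ω k) (T : HubbardGrassmann L M) (m : ℕ) (Ω : Fin m → SectorLeg N) (x : Fin m → SpaceTimeIdx L M) :
    sectorisedKernel L M β F (ExteriorAlgebra.map (LinearMap.mulLeft ℂ (fun K : HubbardFieldIdx L M => g K.1.1)) T) m Ω x =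
      sectorisedKernel L M β F T m Ω x := by
  rw [klbv_sectorisedKernel_map_mulLeft]
  have hF : (fun ω k => F ω k * g k) = F := funext fun ω => funext fun k => hFg ω k
  rw [hF]

omit [NeZero L] in
/-- **Absorption from support**: a cut `g` with `g = 1` wherever some multiplier of the family is non-zero is absorbed (`F_ω·g = F_ω`). -/
theorem klbv_absorb_of_eq_one_on_support {N : ℕ} (F : Fin N → FreqMomentum L M → ℂ) (g : FreqMomentum L M → ℂ)
    (hg : ∀ ω k, F ω k ≠ 0 → g k = 1) (ω : Fin N) (k : FreqMomentum L M) : F ω k * g k = F ω k := by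
  by_cases h : F ω k = 0
  · rw [h, zero_mul]
  · rw [hg ω k h, mul_one]

end Summit.HubbardSuperconductivity.HubbardSuperconductivity.Theorems.KLRegimeSplit

end
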